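import Mathlib.Analysis.Complex.ExponentialBounds
import Literature.NumberTheory.Sieve.RosserSieveLemma14
import Literature.NumberTheory.Sieve.RosserSieveRecurrencesBetaOne
import HarnessLib

/-!
# Iwaniec's Lemma 17 in dimension `1/2` (`β = 1`), with the linear-sieve majorants

Topic `Literature/NumberTheory/Sieve`; Iwaniec, *Rosser's sieve*, Acta Arith. 36 (1980), §7,
Lemma 17 for `κ = 1/2`. For `κ ≤ 1/2` Iwaniec's majorants `q^±` of §6 are not available
(`β_{1/2} = 1`, so (6.1) degenerates), and he majorizes `T^±_R` instead by the `q^±` of a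
dimension `κ₁ > 1/2`, using that the kernel `(1 − 1/t)^{−κ}` of (7.3) is smaller than the kernel
`(1 − 1/t)^{−κ₁−1}` of (7.4) (p. 194, (7.5): "we choose, in this case a `q^±(s)` corresponding to
some `κ₁` slightly greater than `1/2`"). This file carries this out with the explicit choice
`κ₁ = 1`, `β₁ = β_1 = 2` (the linear sieve, `q_1(s) = s − 1`): with `Z⁺ = qUpper 1 2`,
`Z⁻ = qLower 1 2` (positive and super-exponentially decaying by `BetaSieve.majorantHyp_of_greatest`,
`RosserSieveLemma14.lean`; `Z⁺ = 1/2` on `(−∞, 3]`, `Z⁻ = 1` on `(−∞, 2]`,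
`Z⁻(s) = 1 − (log(s − 1) − (s − 1)⁻¹ + 1)/2` on `[2, 4]`), the kernel of (7.3) for `κ = 1/2`
satisfies `k(t) = (1/2) t^{−1/2} (t − 1)^{−1/2} = (1/2)(1 − 1/t)^{3/2} · t (t − 1)^{−2}`, one half of
`(1 − 1/t)^{3/2} ≤ 1` times the kernel of (6.2) for `κ₁ = 1`. Hence (all integrals finite, the
identities (6.2) in integrated form):
`∫_s k Z⁺(· − 1) ≤ Z⁻(s)` for `s ≥ 1` (on `[1, 2]` from `t^{−1/2} ≤ 1`, beyond from (6.2)), and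
`∫_s k Z⁻(· − 1) ≤ Z⁺(s)/2` for `s ≥ 3`, `≤ 0.485 = (1 − 3/100) Z⁺(s)` for `2 ≤ s < 3` (a numerical
estimate: `∫_2^3 dt/(2√(t(t−1))) ≤ log(12/7)/2 ≤ 0.27`, `(3/4)^{3/2} ≤ 13/20`, `log 2 ≤ 0.6932`,
`log(3/2) ≥ 0.405`, giving `Z⁺(4) ≤ 0.2695`). Iwaniec's induction (proof of Lemma 17, with the
"saving" `δ = 3/100` at `s = β + 1 = 2` and `c = 100 ≥ 2√2/δ`) then gives
`T⁻_N(s) ≤ c Z⁻(s)` (`s ≥ 1`) and `T⁺_N(s) ≤ c Z⁺(s)` (`s ≥ 0`) for the partial sums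
`T^± = BetaSieve.contT par (1/2) 1 N` of (7.1)–(7.2) at `β = 1`
(`exists_const_contT_le_half`), using the `β = 1` recurrences of
`RosserSieveRecurrencesBetaOne.lean`. This is the boundedness input for Lemma 18 at `κ = 1/2`
(`BetaSieve.Iwaniec1980_lemma18_half`).

## References

* H. Iwaniec, *Rosser's sieve*, Acta Arith. 36 (1980), 171–202: §6 (6.1)–(6.2); §7 (7.3)–(7.6),
  Lemma 17 and its proof, pp. 194–195. [IwaniecActaArith1980]
-/

open Filter Set MeasureTheory intervalIntegral
open scoped Topology

noncomputable section

namespace Literature.NumberTheory.Sieve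

namespace BetaSieve

open BetaSieveForward (sieveKernel sieveKernel_nonneg continuousOn_sieveKernel)
open RosserMajorant

/-! ### Numerical constants -/

/-- `log 2 ≤ 0.6932`. [folklore] -/
theorem log_two_le : Real.log 2 ≤ 0.6932 := Real.log_two_lt_d9.le.trans (by norm_num)

/-- `log(3/2) ≥ 0.405` (`e^{0.405} ≤ 3/2` by the Taylor bound of order `5`). [folklore] -/
theorem log_three_halves_ge : (0.405 : ℝ) ≤ Real.log (3 / 2) := by
  rw [Real.le_log_iff_exp_le (by norm_num)]
  have h := Real.exp_bound' (x := 0.405) (by norm_num) (by norm_num) (n := 5) (by norm_num)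
  refine h.trans ?_
  simp only [Finset.sum_range_succ, Finset.sum_range_zero, Nat.factorial]
  norm_num

/-- `log(12/7) ≤ 0.54` (`12/7 ≤ ∑_{i<6} 0.54^i/i! ≤ e^{0.54}`). [folklore] -/
theorem log_twelve_sevenths_le : Real.log (12 / 7) ≤ 0.54 := by
  rw [Real.log_le_iff_le_exp (by norm_num)]
  refine le_trans ?_ (Real.sum_le_exp_of_nonneg (x := 0.54) (by norm_num) 6)
  simp only [Finset.sum_range_succ, Finset.sum_range_zero, Nat.factorial]
  norm_num

/-- `(3/4)^{3/2} ≤ 13/20` (`(3/4)³ = 27/64 ≤ (13/20)² = 169/400`). [folklore] -/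
theorem three_quarters_rpow_le : ((3:ℝ) / 4) ^ ((3:ℝ) / 2) ≤ 13 / 20 := by
  have h : (((3:ℝ) / 4) ^ ((3:ℝ) / 2)) ^ (2:ℕ) = 27 / 64 := by
    rw [← Real.rpow_natCast, ← Real.rpow_mul (by norm_num)]
    norm_num
  have hpos : 0 ≤ ((3:ℝ) / 4) ^ ((3:ℝ) / 2) := Real.rpow_nonneg (by norm_num) _
  nlinarith

/-- `2^{1/2} ≤ 3/2`. [folklore] -/
theorem two_rpow_half_le : (2:ℝ) ^ (1 / 2 : ℝ) ≤ 3 / 2 := by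
  have h : ((2:ℝ) ^ (1 / 2 : ℝ)) ^ (2:ℕ) = 2 := by
    rw [← Real.rpow_natCast, ← Real.rpow_mul (by norm_num)]
    norm_num
  have hpos : 0 ≤ (2:ℝ) ^ (1 / 2 : ℝ) := Real.rpow_nonneg (by norm_num) _
  nlinarith

/-! ### The linear-sieve majorants `Z⁺ = qUpper 1 2`, `Z⁻ = qLower 1 2` -/

/-- **The majorant hypotheses for `(κ₁, β₁) = (1, 2)`**: `q^±` of the linear sieve are positive on
`(0, ∞)` and decay super-exponentially (`majorantHyp_of_greatest` for the greatest data of dimension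
`1`, whose `β` is `2`, `IsBetaSieveSolution.beta_eq_two`). [cite: IwaniecActaArith1980, Lemma 13] -/
theorem majorantHyp_one_two : MajorantHyp 1 2 := by
  have hB := isGreatestBetaSieveData_greatestBetaSieveData' (by norm_num : (1 / 2 : ℝ) ≤ 1)
  have hm := majorantHyp_of_greatest (by norm_num : (1 / 2 : ℝ) < 1) hB
  have hβ : (greatestBetaSieveData 1).2.2.1 = 2 := hB.1.beta_eq_two
  rwa [hβ] at hm

/-- `Z⁺(s) = 1/2` for `s ≤ 3` ((6.1)). [cite: IwaniecActaArith1980, §6 (6.1)] -/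
theorem zUpper_eq {s : ℝ} (hs : s ≤ 3) : qUpper 1 2 s = 1 / 2 := by
  rw [qUpper_eq (by linarith : s ≤ (2:ℝ) + 1), Real.rpow_neg (by norm_num), Real.rpow_one]
  norm_num

/-- `Z⁻(s) = 1` for `s ≤ 2` ((6.1)). [cite: IwaniecActaArith1980, §6 (6.1)] -/
theorem zLower_eq {s : ℝ} (hs : s ≤ 2) : qLower 1 2 s = 1 := by
  rw [qLower_eq hs]
  norm_num

/-- `Z⁺ > 0` everywhere. [cite: IwaniecActaArith1980, Lemma 13] -/
theorem zUpper_pos (s : ℝ) : 0 < qUpper 1 2 s := by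
  rcases le_or_gt s 3 with h | h
  · rw [zUpper_eq h]; norm_num
  · exact (majorantHyp_one_two.pos s (by linarith)).1

/-- `Z⁻ > 0` everywhere. [cite: IwaniecActaArith1980, Lemma 13] -/
theorem zLower_pos (s : ℝ) : 0 < qLower 1 2 s := by
  rcases le_or_gt s 2 with h | h
  · rw [zLower_eq h]; norm_num
  · exact (majorantHyp_one_two.pos s (by linarith)).2

/-- `Z⁺` is continuous on `ℝ` (constant on `(−∞, 3]`, continuous on `(0, ∞)`). [folklore] -/
theorem continuous_zUpper : Continuous (qUpper 1 2) := by
  refine continuous_iff_continuousAt.mpr fun s => ?_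
  rcases lt_or_ge s 3 with h | h
  · refine (continuousAt_const (y := (1 / 2 : ℝ))).congr ?_
    filter_upwards [Iio_mem_nhds h] with t ht
    exact (zUpper_eq (le_of_lt ht)).symm
  · exact (continuousOn_qUpper (by norm_num : (1:ℝ) < 2)).continuousAt
      (Ioi_mem_nhds (by linarith : (0:ℝ) < s))

/-- `Z⁻` is continuous on `ℝ`. [folklore] -/
theorem continuous_zLower : Continuous (qLower 1 2) := by
  refine continuous_iff_continuousAt.mpr fun s => ?_
  rcases lt_or_ge s 2 with h | h
  · refine (continuousAt_const (y := (1 : ℝ))).congr ?_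
    filter_upwards [Iio_mem_nhds h] with t ht
    exact (zLower_eq (le_of_lt ht)).symm
  · exact (continuousOn_qLower (by norm_num : (1:ℝ) < 2)).continuousAt
      (Ioi_mem_nhds (by linarith : (0:ℝ) < s))

/-- The kernel of (6.2) for `κ₁ = 1`: `1 · t¹ · (t − 1)^{−1−1} = t/(t − 1)²` (`t > 1`). [folklore] -/
theorem kOne_eq {t : ℝ} (ht : 1 < t) : 1 * t ^ (1:ℝ) * (t - 1) ^ (-(1:ℝ) - 1) = t / (t - 1) ^ 2 := by
  rw [Real.rpow_one, show (-(1:ℝ) - 1) = -(2:ℝ) by norm_num, Real.rpow_neg (by linarith),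
    Real.rpow_two]
  ring

/-- `(log(u − 1) − (u − 1)⁻¹)' = u/(u − 1)²` for `u > 1`. [folklore] -/
theorem hasDerivAt_log_sub_inv {t : ℝ} (ht : 1 < t) :
    HasDerivAt (fun u : ℝ => Real.log (u - 1) - (u - 1)⁻¹) (t / (t - 1) ^ 2) t := by
  have h1 : HasDerivAt (fun u : ℝ => u - 1) 1 t := (hasDerivAt_id t).sub_const 1
  have hne : t - 1 ≠ 0 := by linarith
  have h := (h1.log hne).sub (h1.inv hne)
  refine h.congr_deriv ?_
  field_simp
  ring

/-- `t ↦ t/(t − 1)²` is continuous on `[a, b]` for `a > 1`. [folklore] -/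
theorem continuousOn_kOne {a b : ℝ} (ha : 1 < a) : ContinuousOn (fun t : ℝ => t / (t - 1) ^ 2) (Icc a b) := by
  refine continuousOn_of_forall_continuousAt fun t ht => ?_
  have hne : (t - 1) ^ 2 ≠ 0 := pow_ne_zero 2 (by linarith [ht.1])
  exact continuousAt_id.div ((continuousAt_id.sub continuousAt_const).pow 2) hne

/-- `∫_a^b t/(t − 1)² dt = [log(t − 1) − (t − 1)⁻¹]_a^b` for `1 < a ≤ b`. [folklore] -/
theorem integral_kOne {a b : ℝ} (ha : 1 < a) (hab : a ≤ b) :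
    ∫ t in a..b, t / (t - 1) ^ 2 =
      (Real.log (b - 1) - (b - 1)⁻¹) - (Real.log (a - 1) - (a - 1)⁻¹) := by
  refine integral_eq_sub_of_hasDerivAt (fun t ht => hasDerivAt_log_sub_inv ?_) ?_
  · rw [uIcc_of_le hab] at ht; linarith [ht.1]
  · refine ContinuousOn.intervalIntegrable ?_
    rw [uIcc_of_le hab]
    exact continuousOn_kOne ha

/-- Integrability of `k(t) Z(t − 1)` on `[s, U]`, `s ≥ 1`, for a continuous `Z`. [folklore] -/
theorem intervalIntegrable_half {Z : ℝ → ℝ} (hZ : Continuous Z) {s U : ℝ} (hs : 1 ≤ s) (hsU : s ≤ U) :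
    IntervalIntegrable (fun t => sieveKernel (1 / 2) t * Z (t - 1)) volume s U :=
  intervalIntegrable_sieveKernel_mul_of_one_le (by norm_num) hZ hs hsU

/-- Integrability of `t (t − 1)^{−2} Z(t − 1)` on `[s, U]`, `s > 1`, for a continuous `Z`. [folklore] -/
theorem intervalIntegrable_kOne_mul {Z : ℝ → ℝ} (hZ : Continuous Z) {s U : ℝ} (hs : 1 < s)
    (hsU : s ≤ U) : IntervalIntegrable (fun t => t / (t - 1) ^ 2 * Z (t - 1)) volume s U := by
  refine ContinuousOn.intervalIntegrable ?_
  rw [uIcc_of_le hsU]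
  exact (continuousOn_kOne hs).mul (hZ.comp (continuous_id.sub continuous_const)).continuousOn

/-- **(6.2) for `Z⁻`, integrated**: `Z⁻(s) − Z⁻(s') = ∫_s^{s'} t (t − 1)^{−2} Z⁺(t − 1) dt ≥ 0` for
`2 ≤ s ≤ s'`. [cite: IwaniecActaArith1980, §6 (6.2)] -/
theorem zLower_sub_eq {s s' : ℝ} (hs : 2 ≤ s) (hss' : s ≤ s') :
    qLower 1 2 s - qLower 1 2 s' = ∫ t in s..s', t / (t - 1) ^ 2 * qUpper 1 2 (t - 1) := by
  rw [qLower_sub_eq_integral (κ := 1) (β := 2) (by norm_num) hs hss']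
  refine integral_congr fun t ht => ?_
  rw [uIcc_of_le hss'] at ht
  rw [kOne_eq (by linarith [ht.1])]

/-- **(6.2) for `Z⁺`, integrated**: `Z⁺(s) − Z⁺(s') = ∫_s^{s'} t (t − 1)^{−2} Z⁻(t − 1) dt` for
`3 ≤ s ≤ s'`. [cite: IwaniecActaArith1980, §6 (6.2)] -/
theorem zUpper_sub_eq {s s' : ℝ} (hs : 3 ≤ s) (hss' : s ≤ s') :
    qUpper 1 2 s - qUpper 1 2 s' = ∫ t in s..s', t / (t - 1) ^ 2 * qLower 1 2 (t - 1) := by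
  rw [qUpper_sub_eq_integral (κ := 1) (β := 2) (by norm_num) (by linarith) hss']
  refine integral_congr fun t ht => ?_
  rw [uIcc_of_le hss'] at ht
  rw [kOne_eq (by linarith [ht.1])]

/-- `Z⁻` is non-increasing on `[2, ∞)`. [cite: IwaniecActaArith1980, §6 (6.2)] -/
theorem zLower_le_zLower {u v : ℝ} (hu : 2 ≤ u) (huv : u ≤ v) : qLower 1 2 v ≤ qLower 1 2 u := by
  have h := zLower_sub_eq hu huv
  have h0 : 0 ≤ ∫ t in u..v, t / (t - 1) ^ 2 * qUpper 1 2 (t - 1) :=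
    integral_nonneg huv fun t ht => mul_nonneg
      (div_nonneg (by linarith [ht.1]) (sq_nonneg _)) (zUpper_pos _).le
  linarith

/-- `Z⁺` is non-increasing on `[3, ∞)`. [cite: IwaniecActaArith1980, §6 (6.2)] -/
theorem zUpper_le_zUpper {u v : ℝ} (hu : 3 ≤ u) (huv : u ≤ v) : qUpper 1 2 v ≤ qUpper 1 2 u := by
  have h := zUpper_sub_eq hu huv
  have h0 : 0 ≤ ∫ t in u..v, t / (t - 1) ^ 2 * qLower 1 2 (t - 1) :=
    integral_nonneg huv fun t ht => mul_nonneg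
      (div_nonneg (by linarith [ht.1]) (sq_nonneg _)) (zLower_pos _).le
  linarith

/-- **`Z⁻(3) = 1 − (log 2 + 1/2)/2`** (one step of (6.2) with `Z⁺ = 1/2` on `[1, 2]`).
[cite: IwaniecActaArith1980, §6 (6.2)] -/
theorem zLower_three : qLower 1 2 3 = 1 - (Real.log 2 + 1 / 2) / 2 := by
  have h := zLower_sub_eq (s := 2) (s' := 3) le_rfl (by norm_num)
  rw [zLower_eq le_rfl] at h
  have hI : ∫ t in (2:ℝ)..3, t / (t - 1) ^ 2 * qUpper 1 2 (t - 1) =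
      (1 / 2) * ((Real.log (3 - 1) - (3 - 1)⁻¹) - (Real.log (2 - 1) - (2 - 1)⁻¹)) := by
    rw [← integral_kOne (by norm_num) (by norm_num), ← intervalIntegral.integral_const_mul]
    refine integral_congr fun t ht => ?_
    rw [uIcc_of_le (by norm_num)] at ht
    rw [zUpper_eq (by linarith [ht.2])]
    ring
  rw [hI] at h
  norm_num at h
  linarith

/-- `Z⁻(3) ≥ 0.4034`. [folklore] -/
theorem zLower_three_ge : (0.4034 : ℝ) ≤ qLower 1 2 3 := by
  rw [zLower_three]
  linarith [log_two_le]

/-- **`Z⁺(4) ≤ 0.2695`**: `Z⁺(3) − Z⁺(4) = ∫_3^4 t (t − 1)^{−2} Z⁻(t − 1) dt ≥ Z⁻(3) (log(3/2) + 1/6)`.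
[cite: IwaniecActaArith1980, §6 (6.2)] -/
theorem zUpper_four_le : qUpper 1 2 4 ≤ 0.2695 := by
  have h := zUpper_sub_eq (s := 3) (s' := 4) le_rfl (by norm_num)
  rw [zUpper_eq le_rfl] at h
  have hK : ∫ t in (3:ℝ)..4, t / (t - 1) ^ 2 = Real.log (3 / 2) + 1 / 6 := by
    rw [integral_kOne (by norm_num) (by norm_num)]
    have : Real.log (4 - 1) - Real.log (3 - 1) = Real.log (3 / 2) := by
      rw [← Real.log_div (by norm_num) (by norm_num)]; norm_num
    linarith
  have hmono : ∫ t in (3:ℝ)..4, t / (t - 1) ^ 2 * qLower 1 2 3 ≤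
      ∫ t in (3:ℝ)..4, t / (t - 1) ^ 2 * qLower 1 2 (t - 1) := by
    refine integral_mono_on (by norm_num) ?_ ?_ fun t ht => ?_
    · refine ContinuousOn.intervalIntegrable ?_
      rw [uIcc_of_le (by norm_num)]
      exact (continuousOn_kOne (by norm_num)).mul continuousOn_const
    · exact intervalIntegrable_kOne_mul continuous_zLower (by norm_num) (by norm_num)
    · exact mul_le_mul_of_nonneg_left (zLower_le_zLower (by linarith [ht.1]) (by linarith [ht.2]))
        (div_nonneg (by linarith [ht.1]) (sq_nonneg _))
  rw [intervalIntegral.integral_mul_const, hK] at hmono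
  have hZ3 := zLower_three_ge
  have hl := log_three_halves_ge
  nlinarith

/-! ### The kernel of (7.3) for `κ = 1/2` against the kernel of (6.2) for `κ₁ = 1` -/

/-- **`k(t) = (1/2)(1 − 1/t)^{3/2} · t/(t − 1)²`** for `t > 1`, `k = sieveKernel (1/2)`.
[cite: IwaniecActaArith1980, §7 (7.5)] -/
theorem sieveKernel_half_eq {t : ℝ} (ht : 1 < t) :
    sieveKernel (1 / 2) t = (1 / 2) * (1 - 1 / t) ^ ((3:ℝ) / 2) * (t / (t - 1) ^ 2) := by
  have ht0 : 0 < t := by linarith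
  have ht1 : 0 < t - 1 := by linarith
  rw [sieveKernel, show 1 - 1 / t = (t - 1) / t by field_simp, Real.div_rpow ht1.le ht0.le]
  -- `t^{1/2 - 1} (t-1)^{-1/2} = (t-1)^{3/2} / t^{3/2} * t / (t-1)^2`
  have e1 : t ^ ((1:ℝ) / 2 - 1) = t / t ^ ((3:ℝ) / 2) := by
    rw [eq_div_iff (Real.rpow_pos_of_pos ht0 _).ne', ← Real.rpow_add ht0]
    norm_num
  have e2 : (t - 1) ^ (-(1 / 2 : ℝ)) = (t - 1) ^ ((3:ℝ) / 2) / (t - 1) ^ 2 := by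
    rw [eq_div_iff (pow_pos ht1 2).ne', ← Real.rpow_two, ← Real.rpow_add ht1]
    norm_num
  rw [e1, e2]
  field_simp

/-- **`k(t) ≤ (1/2) · t/(t − 1)²`** for `t > 1` (`(1 − 1/t)^{3/2} ≤ 1`). [cite: IwaniecActaArith1980, §7 (7.5)] -/
theorem sieveKernel_half_le {t : ℝ} (ht : 1 < t) :
    sieveKernel (1 / 2) t ≤ (1 / 2) * (t / (t - 1) ^ 2) := by
  rw [sieveKernel_half_eq ht]
  have ht0 : 0 < t := by linarith
  have h1 : (1 - 1 / t) ^ ((3:ℝ) / 2) ≤ 1 :=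
    Real.rpow_le_one (by rw [sub_nonneg, div_le_one ht0]; linarith)
      (by rw [sub_le_self_iff]; positivity) (by norm_num)
  have h2 : 0 ≤ t / (t - 1) ^ 2 := div_nonneg ht0.le (sq_nonneg _)
  nlinarith

/-- **`k(t) ≤ (13/40) · t/(t − 1)²`** for `1 < t ≤ 4` (`(1 − 1/t)^{3/2} ≤ (3/4)^{3/2} ≤ 13/20`).
[cite: IwaniecActaArith1980, §7 (7.5)] -/
theorem sieveKernel_half_le_of_le_four {t : ℝ} (ht : 1 < t) (ht4 : t ≤ 4) :
    sieveKernel (1 / 2) t ≤ (13 / 40) * (t / (t - 1) ^ 2) := by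
  rw [sieveKernel_half_eq ht]
  have ht0 : 0 < t := by linarith
  have hbase : 1 - 1 / t ≤ 3 / 4 := by
    rw [show (3:ℝ) / 4 = 1 - 1 / 4 by norm_num]
    gcongr
  have h1 : (1 - 1 / t) ^ ((3:ℝ) / 2) ≤ 13 / 20 :=
    (Real.rpow_le_rpow (by rw [sub_nonneg, div_le_one ht0]; linarith) hbase (by norm_num)).trans
      three_quarters_rpow_le
  have h2 : 0 ≤ t / (t - 1) ^ 2 := div_nonneg ht0.le (sq_nonneg _)
  nlinarith

/-- **`k(t) ≤ (1/2)(t − 1)^{−1/2}`** for `t > 1` (`t^{−1/2} ≤ 1`). [folklore] -/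
theorem sieveKernel_half_le_rpow {t : ℝ} (ht : 1 < t) :
    sieveKernel (1 / 2) t ≤ (1 / 2) * (t - 1) ^ (-(1 / 2 : ℝ)) := by
  rw [sieveKernel]
  have h1 : t ^ ((1:ℝ) / 2 - 1) ≤ 1 :=
    Real.rpow_le_one_of_one_le_of_nonpos ht.le (by norm_num)
  have h2 : 0 ≤ (t - 1) ^ (-(1 / 2 : ℝ)) := Real.rpow_nonneg (by linarith) _
  nlinarith

/-- **`k(t) ≤ (1/2)(t − 3/5)⁻¹`** for `t ≥ 9/5` (`√(t(t − 1)) ≥ t − 3/5` there). [folklore] -/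
theorem sieveKernel_half_le_inv {t : ℝ} (ht : 9 / 5 ≤ t) :
    sieveKernel (1 / 2) t ≤ (1 / 2) * (t - 3 / 5)⁻¹ := by
  have ht0 : 0 < t := by linarith
  have ht1 : 0 < t - 1 := by linarith
  have e : t ^ ((1:ℝ) / 2 - 1) * (t - 1) ^ (-(1 / 2 : ℝ)) = (Real.sqrt (t * (t - 1)))⁻¹ := by
    rw [show ((1:ℝ) / 2 - 1) = -(1 / 2 : ℝ) by norm_num, Real.rpow_neg ht0.le, Real.rpow_neg ht1.le,
      ← mul_inv, ← Real.mul_rpow ht0.le ht1.le, Real.sqrt_eq_rpow]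
  rw [sieveKernel, mul_assoc, e]
  have hsq : t - 3 / 5 ≤ Real.sqrt (t * (t - 1)) := by
    have h1 : Real.sqrt ((t - 3 / 5) ^ 2) = t - 3 / 5 := Real.sqrt_sq (by linarith)
    rw [← h1]
    exact Real.sqrt_le_sqrt (by nlinarith)
  have hpos : 0 < t - 3 / 5 := by linarith
  exact mul_le_mul_of_nonneg_left (inv_anti₀ hpos hsq) (by norm_num)

/-! ### The majorant inequalities (7.6) for `κ = 1/2` -/

/-- **`∫_s^U k(t) Z⁺(t − 1) dt ≤ (Z⁻(s) − Z⁻(U))/2`** for `2 ≤ s ≤ U` (kernel comparison and (6.2)).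
[cite: IwaniecActaArith1980, §7 (7.4)–(7.5)] -/
theorem integral_half_zUpper_le {s U : ℝ} (hs : 2 ≤ s) (hsU : s ≤ U) :
    ∫ t in s..U, sieveKernel (1 / 2) t * qUpper 1 2 (t - 1) ≤ (qLower 1 2 s - qLower 1 2 U) / 2 := by
  rw [zLower_sub_eq hs hsU, ← intervalIntegral.integral_div]
  refine integral_mono_on hsU (intervalIntegrable_half continuous_zUpper (by linarith) hsU)
    ((intervalIntegrable_kOne_mul continuous_zUpper (by linarith) hsU).div_const 2) fun t ht => ?_
  have ht1 : 1 < t := by linarith [ht.1]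
  have hz := (zUpper_pos (t - 1)).le
  calc sieveKernel (1 / 2) t * qUpper 1 2 (t - 1) ≤ (1 / 2) * (t / (t - 1) ^ 2) * qUpper 1 2 (t - 1) :=
        mul_le_mul_of_nonneg_right (sieveKernel_half_le ht1) hz
    _ = t / (t - 1) ^ 2 * qUpper 1 2 (t - 1) / 2 := by ring

/-- **`∫_s^U k(t) Z⁻(t − 1) dt ≤ (Z⁺(s) − Z⁺(U))/2`** for `3 ≤ s ≤ U`.
[cite: IwaniecActaArith1980, §7 (7.4)–(7.5)] -/
theorem integral_half_zLower_le {s U : ℝ} (hs : 3 ≤ s) (hsU : s ≤ U) :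
    ∫ t in s..U, sieveKernel (1 / 2) t * qLower 1 2 (t - 1) ≤ (qUpper 1 2 s - qUpper 1 2 U) / 2 := by
  rw [zUpper_sub_eq hs hsU, ← intervalIntegral.integral_div]
  refine integral_mono_on hsU (intervalIntegrable_half continuous_zLower (by linarith) hsU)
    ((intervalIntegrable_kOne_mul continuous_zLower (by linarith) hsU).div_const 2) fun t ht => ?_
  have ht1 : 1 < t := by linarith [ht.1]
  have hz := (zLower_pos (t - 1)).le
  calc sieveKernel (1 / 2) t * qLower 1 2 (t - 1) ≤ (1 / 2) * (t / (t - 1) ^ 2) * qLower 1 2 (t - 1) :=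
        mul_le_mul_of_nonneg_right (sieveKernel_half_le ht1) hz
    _ = t / (t - 1) ^ 2 * qLower 1 2 (t - 1) / 2 := by ring

/-- `∫_3^4 k(t) Z⁻(t − 1) dt ≤ (13/40)(Z⁺(3) − Z⁺(4))` (the refined comparison on `t ≤ 4`).
[cite: IwaniecActaArith1980, §7 (7.5)] -/
theorem integral_half_zLower_three_four_le :
    ∫ t in (3:ℝ)..4, sieveKernel (1 / 2) t * qLower 1 2 (t - 1) ≤
      (13 / 40) * (qUpper 1 2 3 - qUpper 1 2 4) := by
  rw [zUpper_sub_eq le_rfl (by norm_num), ← intervalIntegral.integral_const_mul]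
  refine integral_mono_on (by norm_num) (intervalIntegrable_half continuous_zLower (by norm_num)
    (by norm_num)) ((intervalIntegrable_kOne_mul continuous_zLower (by norm_num)
      (by norm_num)).const_mul _) fun t ht => ?_
  have ht1 : 1 < t := by linarith [ht.1]
  have hz := (zLower_pos (t - 1)).le
  calc sieveKernel (1 / 2) t * qLower 1 2 (t - 1)
      ≤ (13 / 40) * (t / (t - 1) ^ 2) * qLower 1 2 (t - 1) :=
        mul_le_mul_of_nonneg_right (sieveKernel_half_le_of_le_four ht1 ht.2) hz
    _ = 13 / 40 * (t / (t - 1) ^ 2 * qLower 1 2 (t - 1)) := by ring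

/-- `∫_2^3 k(t) Z⁻(t − 1) dt ≤ log(12/7)/2 ≤ 0.27` (`Z⁻ = 1` on `[1, 2]`, `k(t) ≤ (t − 3/5)⁻¹/2`).
[folklore] -/
theorem integral_half_zLower_two_three_le :
    ∫ t in (2:ℝ)..3, sieveKernel (1 / 2) t * qLower 1 2 (t - 1) ≤ 0.27 := by
  have hmono : ∫ t in (2:ℝ)..3, sieveKernel (1 / 2) t * qLower 1 2 (t - 1) ≤
      ∫ t in (2:ℝ)..3, (1 / 2) * (t - 3 / 5)⁻¹ := by
    refine integral_mono_on (by norm_num) (intervalIntegrable_half continuous_zLower (by norm_num)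
      (by norm_num)) ?_ fun t ht => ?_
    · refine ContinuousOn.intervalIntegrable ?_
      rw [uIcc_of_le (by norm_num)]
      refine continuousOn_of_forall_continuousAt fun t ht => ?_
      have hne : t - 3 / 5 ≠ 0 := by linarith [ht.1]
      exact continuousAt_const.mul ((continuousAt_id.sub continuousAt_const).inv₀ hne)
    · rw [zLower_eq (by linarith [ht.2]), mul_one]
      exact sieveKernel_half_le_inv (by linarith [ht.1])
  have hI : ∫ t in (2:ℝ)..3, (1 / 2) * (t - 3 / 5)⁻¹ = (1 / 2) * Real.log (12 / 7) := by
    rw [intervalIntegral.integral_const_mul]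
    have h := intervalIntegral.integral_comp_sub_right (fun x : ℝ => x⁻¹) (3 / 5 : ℝ) (a := 2) (b := 3)
    rw [h, integral_inv_of_pos (by norm_num) (by norm_num)]
    norm_num
  rw [hI] at hmono
  linarith [log_twelve_sevenths_le]

/-- **The `+` majorant inequality on `[2, 3)` with the saving `3/100`**: for `2 ≤ s` and `U ≥ 4`,
`∫_s^U k(t) Z⁻(t − 1) dt ≤ 0.485 = (1 − 3/100) Z⁺(s)`. [cite: IwaniecActaArith1980, Lemma 17 (proof)] -/
theorem integral_half_zLower_le_of_two_le {s U : ℝ} (hs : 2 ≤ s) (hsU : s ≤ U) (hU : 4 ≤ U) :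
    ∫ t in s..U, sieveKernel (1 / 2) t * qLower 1 2 (t - 1) ≤ 0.485 := by
  have hnn : ∀ a b, 1 ≤ a → a ≤ b → 0 ≤ ∫ t in a..b, sieveKernel (1 / 2) t * qLower 1 2 (t - 1) :=
    fun a b ha hab => integral_nonneg hab fun t ht =>
      mul_nonneg (sieveKernel_nonneg (by norm_num) (by linarith [ht.1])) (zLower_pos _).le
  have hint : ∀ a b, 1 ≤ a → a ≤ b →
      IntervalIntegrable (fun t => sieveKernel (1 / 2) t * qLower 1 2 (t - 1)) volume a b :=
    fun a b ha hab => intervalIntegrable_half continuous_zLower ha hab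
  -- `∫_s^U ≤ ∫_2^U = ∫_2^3 + ∫_3^4 + ∫_4^U`
  have h1 : ∫ t in s..U, sieveKernel (1 / 2) t * qLower 1 2 (t - 1) ≤
      ∫ t in (2:ℝ)..U, sieveKernel (1 / 2) t * qLower 1 2 (t - 1) := by
    rw [← integral_add_adjacent_intervals (hint 2 s (by norm_num) hs) (hint s U (by linarith) hsU)]
    linarith [hnn 2 s (by norm_num) hs]
  have h2 : ∫ t in (2:ℝ)..U, sieveKernel (1 / 2) t * qLower 1 2 (t - 1) =
      (∫ t in (2:ℝ)..3, sieveKernel (1 / 2) t * qLower 1 2 (t - 1)) +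
        ((∫ t in (3:ℝ)..4, sieveKernel (1 / 2) t * qLower 1 2 (t - 1)) +
          ∫ t in (4:ℝ)..U, sieveKernel (1 / 2) t * qLower 1 2 (t - 1)) := by
    rw [integral_add_adjacent_intervals (hint 3 4 (by norm_num) (by norm_num))
      (hint 4 U (by norm_num) hU),
      integral_add_adjacent_intervals (hint 2 3 (by norm_num) (by norm_num))
      (hint 3 U (by norm_num) (by linarith))]
  have hA := integral_half_zLower_two_three_le
  have hB := integral_half_zLower_three_four_le
  have hC := integral_half_zLower_le (s := 4) (U := U) (by norm_num) hU
  have hZ4 := zUpper_four_le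
  have hZ3 : qUpper 1 2 3 = 1 / 2 := zUpper_eq le_rfl
  have hZU : 0 ≤ qUpper 1 2 U := (zUpper_pos U).le
  rw [hZ3] at hB
  linarith

/-- **The `−` majorant inequality on `[1, 2)`**: for `1 ≤ s ≤ 2 ≤ U`,
`∫_s^U k(t) Z⁺(t − 1) dt ≤ 1 = Z⁻(s)` (`∫_s^2 ≤ 1/2` from `k(t) ≤ (t − 1)^{−1/2}/2`, `Z⁺ = 1/2`;
`∫_2^U ≤ Z⁻(2)/2 = 1/2`). [cite: IwaniecActaArith1980, Lemma 17 (proof), (7.5)] -/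
theorem integral_half_zUpper_le_one {s U : ℝ} (hs : 1 ≤ s) (hs2 : s ≤ 2) (hU : 2 ≤ U) :
    ∫ t in s..U, sieveKernel (1 / 2) t * qUpper 1 2 (t - 1) ≤ 1 := by
  have hint : ∀ a b, 1 ≤ a → a ≤ b →
      IntervalIntegrable (fun t => sieveKernel (1 / 2) t * qUpper 1 2 (t - 1)) volume a b :=
    fun a b ha hab => intervalIntegrable_half continuous_zUpper ha hab
  rw [← integral_add_adjacent_intervals (hint s 2 hs hs2) (hint 2 U (by norm_num) hU)]
  -- first piece
  have h1 : ∫ t in s..2, sieveKernel (1 / 2) t * qUpper 1 2 (t - 1) ≤ 1 / 2 := by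
    have hmono : ∫ t in s..2, sieveKernel (1 / 2) t * qUpper 1 2 (t - 1) ≤
        ∫ t in s..2, (1 / 4) * (t - 1) ^ (-(1 / 2 : ℝ)) := by
      refine integral_mono_on_of_le_Ioo hs2 (hint s 2 hs hs2) ?_ fun t ht => ?_
      · have h := (intervalIntegral.intervalIntegrable_rpow' (a := s - 1) (b := 2 - 1)
          (r := -(1 / 2 : ℝ)) (by norm_num)).comp_sub_right 1
        simp only [sub_add_cancel] at h
        exact (h.const_mul (1 / 4)).congr fun t _ => by ring_nf
      · have ht1 : 1 < t := by linarith [ht.1]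
        rw [zUpper_eq (by linarith [ht.2])]
        have := sieveKernel_half_le_rpow ht1
        have h0 : 0 ≤ (t - 1) ^ (-(1 / 2 : ℝ)) := Real.rpow_nonneg (by linarith) _
        nlinarith
    have hI : ∫ t in s..2, (1 / 4) * (t - 1) ^ (-(1 / 2 : ℝ)) =
        (1 / 4) * (((2:ℝ) - 1) ^ (-(1 / 2 : ℝ) + 1) - (s - 1) ^ (-(1 / 2 : ℝ) + 1)) / (-(1 / 2 : ℝ) + 1) := by
      rw [intervalIntegral.integral_const_mul]
      have h := intervalIntegral.integral_comp_sub_right (fun x : ℝ => x ^ (-(1 / 2 : ℝ))) (1:ℝ)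
        (a := s) (b := 2)
      rw [h, integral_rpow (Or.inl (by norm_num))]
      ring
    rw [hI] at hmono
    have hs1 : 0 ≤ (s - 1) ^ (-(1 / 2 : ℝ) + 1) := Real.rpow_nonneg (by linarith) _
    norm_num at hmono
    nlinarith
  -- second piece
  have h2 := integral_half_zUpper_le (s := 2) (U := U) le_rfl hU
  rw [zLower_eq le_rfl] at h2
  have hZU : 0 ≤ qLower 1 2 U := (zLower_pos U).le
  linarith

/-- **Uniform form of the `−` majorant bound**: `∫_s^U k(t) Z⁺(t − 1) dt ≤ 1` for all `1 ≤ s ≤ U`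
(`≤ 1/2 + Z⁻(2)/2` through `[1, 2]`, `≤ Z⁻(s)/2 ≤ 1/2` beyond). [cite: IwaniecActaArith1980, Lemma 17 (proof)] -/
theorem integral_half_zUpper_le_one_of_le {s U : ℝ} (hs : 1 ≤ s) (hsU : s ≤ U) :
    ∫ t in s..U, sieveKernel (1 / 2) t * qUpper 1 2 (t - 1) ≤ 1 := by
  have hint : ∀ a b, 1 ≤ a → a ≤ b →
      IntervalIntegrable (fun t => sieveKernel (1 / 2) t * qUpper 1 2 (t - 1)) volume a b :=
    fun a b ha hab => intervalIntegrable_half continuous_zUpper ha hab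
  have hnn : ∀ a b, 1 ≤ a → a ≤ b → 0 ≤ ∫ t in a..b, sieveKernel (1 / 2) t * qUpper 1 2 (t - 1) :=
    fun a b ha hab => integral_nonneg hab fun t ht =>
      mul_nonneg (sieveKernel_nonneg (by norm_num) (by linarith [ht.1])) (zUpper_pos _).le
  rcases le_or_gt s 2 with h2 | h2
  · -- extend to `max U 2 ≥ 2` and use the bound through `[1, 2]`
    have hU2 : U ≤ max U 2 := le_max_left _ _
    have h := integral_half_zUpper_le_one hs h2 (le_max_right U 2)
    rw [← integral_add_adjacent_intervals (hint s U hs hsU) (hint U (max U 2) (hs.trans hsU) hU2)] at h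
    linarith [hnn U (max U 2) (hs.trans hsU) hU2]
  · have h := integral_half_zUpper_le h2.le hsU
    have hZs : qLower 1 2 s ≤ 1 := (zLower_le_zLower le_rfl h2.le).trans_eq (zLower_eq le_rfl)
    have hZU : 0 ≤ qLower 1 2 U := (zLower_pos U).le
    linarith

/-- **Uniform form of the `+` majorant bound**: `∫_s^U k(t) Z⁻(t − 1) dt ≤ 1/2` for all
`2 ≤ s ≤ U`. [cite: IwaniecActaArith1980, Lemma 17 (proof)] -/
theorem integral_half_zLower_le_half_of_le {s U : ℝ} (hs : 2 ≤ s) (hsU : s ≤ U) :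
    ∫ t in s..U, sieveKernel (1 / 2) t * qLower 1 2 (t - 1) ≤ 1 / 2 := by
  have hint : ∀ a b, 1 ≤ a → a ≤ b →
      IntervalIntegrable (fun t => sieveKernel (1 / 2) t * qLower 1 2 (t - 1)) volume a b :=
    fun a b ha hab => intervalIntegrable_half continuous_zLower ha hab
  have hnn : ∀ a b, 1 ≤ a → a ≤ b → 0 ≤ ∫ t in a..b, sieveKernel (1 / 2) t * qLower 1 2 (t - 1) :=
    fun a b ha hab => integral_nonneg hab fun t ht =>
      mul_nonneg (sieveKernel_nonneg (by norm_num) (by linarith [ht.1])) (zLower_pos _).le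
  have hU4 : U ≤ max U 4 := le_max_left _ _
  have h := integral_half_zLower_le_of_two_le hs (hsU.trans hU4) (le_max_right U 4)
  rw [← integral_add_adjacent_intervals (hint s U (by linarith) hsU)
    (hint U (max U 4) (by linarith) hU4)] at h
  linarith [hnn U (max U 4) (by linarith) hU4]

/-! ### Lemma 17 for `κ = 1/2`, `β = 1` -/

/-- **Lemma 17 in dimension `1/2`** (Iwaniec, Lemma 17 with (7.5): "`T^±_R(s) < c q^±(s)` for
`s ≥ β ∓ (1∓1)/2… if `κ ≤ 1/2` we choose a `q^±` corresponding to some `κ₁ > 1/2`"), here with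
`κ₁ = 1`: there is `c > 0` (in fact `c = 100`) such that for all `N`,
`T⁻_N(s) ≤ c Z⁻(s)` for `s ≥ 1` and `T⁺_N(s) ≤ c Z⁺(s)` for `s ≥ 0`, where
`T^∓_N = contT 0/1 (1/2) 1 N` are the partial sums of (7.1)–(7.2) at `β = 1` and
`Z^± = qUpper/qLower 1 2`. [cite: IwaniecActaArith1980, Lemma 17 with (7.5)] -/
theorem exists_const_contT_le_half :
    ∃ c : ℝ, 0 < c ∧ ∀ N : ℕ,
      (∀ s : ℝ, 1 ≤ s → contT 0 (1 / 2) 1 N s ≤ c * qLower 1 2 s) ∧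
      (∀ s : ℝ, 0 ≤ s → contT 1 (1 / 2) 1 N s ≤ c * qUpper 1 2 s) := by
  refine ⟨100, by norm_num, fun N => ?_⟩
  have hκ0 : (0:ℝ) ≤ 1 / 2 := by norm_num
  have hκ1 : (1 / 2 : ℝ) < 1 := by norm_num
  induction N with
  | zero =>
    refine ⟨fun s _ => ?_, fun s _ => ?_⟩
    · rw [contT_zero_right]; exact mul_nonneg (by norm_num) (zLower_pos s).le
    · rw [contT_zero_right]; exact mul_nonneg (by norm_num) (zUpper_pos s).le
  | succ N ih =>
    obtain ⟨ihM, ihP⟩ := ih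
    -- pointwise comparison of the integrands
    have hptP : ∀ t, 1 ≤ t → sieveKernel (1 / 2) t * contT 1 (1 / 2) 1 N (t - 1) ≤
        100 * (sieveKernel (1 / 2) t * qUpper 1 2 (t - 1)) := fun t ht => by
      have := mul_le_mul_of_nonneg_left (ihP (t - 1) (by linarith)) (sieveKernel_nonneg hκ0 ht)
      linarith
    have hptM : ∀ t, 2 ≤ t → sieveKernel (1 / 2) t * contT 0 (1 / 2) 1 N (t - 1) ≤
        100 * (sieveKernel (1 / 2) t * qLower 1 2 (t - 1)) := fun t ht => by
      have := mul_le_mul_of_nonneg_left (ihM (t - 1) (by linarith))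
        (sieveKernel_nonneg hκ0 (by linarith))
      linarith
    -- the `−` bound
    have hM : ∀ s : ℝ, 1 ≤ s → contT 0 (1 / 2) 1 (N + 1) s ≤ 100 * qLower 1 2 s := by
      intro s hs
      set U : ℝ := max (max s (1 + N + 1)) 4 with hUdef
      have hU4 : 4 ≤ U := le_max_right _ _
      have hsU : s ≤ U := (le_max_left _ _).trans (le_max_left _ _)
      rw [contT_zero_succ_eq_integral_one hκ0 hκ1 N hs (le_max_left _ _)]
      have hmono : ∫ t in s..U, sieveKernel (1 / 2) t * contT 1 (1 / 2) 1 N (t - 1) ≤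
          ∫ t in s..U, 100 * (sieveKernel (1 / 2) t * qUpper 1 2 (t - 1)) :=
        integral_mono_on hsU (intervalIntegrable_half (continuous_contT_one hκ0 hκ1 1 N) hs hsU)
          ((intervalIntegrable_half continuous_zUpper hs hsU).const_mul _) fun t ht => hptP t (hs.trans ht.1)
      rw [intervalIntegral.integral_const_mul] at hmono
      refine hmono.trans ?_
      rcases lt_or_ge s 2 with h2 | h2
      · have h := integral_half_zUpper_le_one (U := U) hs h2.le (by linarith)
        rw [zLower_eq h2.le]
        linarith
      · have h := integral_half_zUpper_le h2 hsU
        have hZU : 0 ≤ qLower 1 2 U := (zLower_pos U).le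
        have hZs : 0 ≤ qLower 1 2 s := (zLower_pos s).le
        linarith
    -- the `+` bound for `s ≥ 2`, with the saving on `[2, 3)`
    have hP2 : ∀ s : ℝ, 2 ≤ s → contT 1 (1 / 2) 1 (N + 1) s ≤ 100 * qUpper 1 2 s ∧
        (s < 3 → contT 1 (1 / 2) 1 (N + 1) s ≤ 100 * 0.485) := by
      intro s hs
      set U : ℝ := max (max s (1 + N + 1)) 4 with hUdef
      have hU4 : 4 ≤ U := le_max_right _ _
      have hsU : s ≤ U := (le_max_left _ _).trans (le_max_left _ _)
      rw [contT_one_succ_eq_integral_one hκ0 hκ1 N hs (le_max_left _ _)]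
      have hmono : ∫ t in s..U, sieveKernel (1 / 2) t * contT 0 (1 / 2) 1 N (t - 1) ≤
          ∫ t in s..U, 100 * (sieveKernel (1 / 2) t * qLower 1 2 (t - 1)) :=
        integral_mono_on hsU (intervalIntegrable_half (continuous_contT_one hκ0 hκ1 0 N)
          (by linarith) hsU)
          ((intervalIntegrable_half continuous_zLower (by linarith) hsU).const_mul _)
          fun t ht => hptM t (hs.trans ht.1)
      rw [intervalIntegral.integral_const_mul] at hmono
      have hsave := integral_half_zLower_le_of_two_le hs hsU hU4
      refine ⟨hmono.trans ?_, fun h3 => hmono.trans (by linarith)⟩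
      rcases lt_or_ge s 3 with h3 | h3
      · rw [zUpper_eq h3.le]; linarith
      · have h := integral_half_zLower_le h3 hsU
        have hZU : 0 ≤ qUpper 1 2 U := (zUpper_pos U).le
        have hZs : 0 ≤ qUpper 1 2 s := (zUpper_pos s).le
        linarith
    refine ⟨hM, fun s hs => ?_⟩
    rcases le_or_gt 2 s with h2 | h2
    · exact (hP2 s h2).1
    · -- `0 ≤ s < 2`: (7.3), third line, and the saving at `s = 2`
      have h2' := (hP2 2 le_rfl).2 (by norm_num)
      rw [contT_one_eq_of_le (by omega) (by linarith : s ≤ (1:ℝ) + 1), zUpper_eq (by linarith)]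
      have hs0 : 0 ≤ s ^ (1 / 2 : ℝ) := Real.rpow_nonneg hs _
      have h2r := two_rpow_half_le
      norm_num at h2' ⊢
      linarith

end BetaSieve

end Literature.NumberTheory.Sieve
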